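import Literature.ComputerArithmetic.HallmanIpsen2023.MartingaleBounds
import Literature.ComputerArithmetic.HallmanIpsen2023.ComputationalTree
import HarnessLib

/-!
# Probabilistic error bounds for summation on a computational tree
(Hallman–Ipsen 2023, §2.2 "Setting up martingales on computational trees": Lemma 11,
Theorem 12, Corollary 13, Theorem 15, Corollary 17 of the arXiv text)

HONEST FRAMING (ENGINES group, unit `eng-quad-4`, kernels lane of the `certquad` engine — shared
numerical engines serving client cells; rigour lives in the verifiers; every published number
belongs to a client cell's ledger, not to the engines group): MODEL-form mathematics from the
literature, typed and PROVED; nothing here is new and nothing enters as a named fact. It is the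
probabilistic counterpart of `ComputationalTree.lean` (the deterministic bounds of the same paper):
under mean-independent roundoffs the error of summing `n` numbers in ANY order (any computational
tree of height `h`) is, with probability at least `1 − (δ + η)`, at most
`u √(2 ln(2/δ)) (1 + φ) (Σ_k s_k²)^{1/2} ≤ u √h √(2 ln(2/δ)) (1 + φ) Σ_k |x_k|` — growth `√h·u`
instead of the deterministic `h·u` — where `φ = λ √(2h) u exp(λ² h u²)`, `λ = √(2 ln(2ñ/η))`, is a
second-order quantity.

## Sources

* E. Hallman, I. C. F. Ipsen, *Precision-aware deterministic and probabilistic error bounds for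
  floating point summation*, Numer. Math. 155 (2023) 83–119, doi 10.1007/s00211-023-01370-y,
  arXiv:2203.15928 — bib key `HallmanIpsen2023`; read at the arXiv text, whose running numbers are
  used: §2.1 Lemma 9 (second explicit expression `e_n = Σ_j (s_j + f_j) δ_j`, child-errors
  `f_k = Σ_{j≺k} (s_j + f_j) δ_j`, eq. (eqn:frecurrence)); §2.2 Lemma 11 (lemma:fBound: with
  probability ≥ `1 − η` all `|f_k| ≤ F_{k,ñ,η}`, eq. (eqn:FBoundRecurrence)
  `F_k = λ_{ñ,η} u (Σ_{j≺k} (|s_j| + F_j)²)^{1/2}`, `λ_{ñ,η} = √(2 ln(2ñ/η))`, `ñ = n − L − 1` the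
  number of nodes with at least one non-leaf child), Theorem 12 (thm:model2Theorem:
  `|e_n| ≤ u √(2 ln(2/δ)) (Σ_j (|s_j| + F_{j,ñ,η})²)^{1/2}` with probability ≥ `1 − (δ + η)`),
  Corollary 13 (c_28: the same with `λ_{n,η}`), Remark 14 (the proof strategy), Theorem 15
  (thm:model2Analysis: the closed form with `φ_{ñ,h,η} = λ_{ñ,η} √(2h) u exp(λ²_{ñ,η} h u²)`, via
  eq. (eqn:model2binomials) `Σ_{j=0}^h λ^j u^j √(h choose j)` and the Cauchy–Schwarz / binomial /
  `e^y − 1 ≤ y e^y` chain), Corollary 17 (c_210: the same with `λ_{n,η}`, `φ_{n,h,η}`).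
* `MartingaleBounds.lean` (this directory): the roundoff model (model:second) =
  `ConnollyHighamMary2021.SRErrorModel μ u δ` and HI Lemmas 2–3 (Azuma–Hoeffding, relaxed form) for
  predictable martingale transforms; `ComputationalTree.lean`: `CompTree`, `exact`/`comp`/`err`/
  `childErr`/`sumSqPartial`/`height`/`absInputs`, Lemma 5 (`sumSqPartial_le`), Lemma 9
  (`err_node_eq_childErr`).

## How the tree meets the probability space

A summation algorithm is a TREE SHAPE with the inputs at the leaves; running it commits one
roundoff per node. `STree` records the shape, the (real) inputs and, at every node, the INDEX `k`
of the roundoff `δ_k` committed there (HI number the nodes `2, …, n` in computation order); for an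
outcome `ω` the realised computational tree is `T.inst (fun k => δ k ω) : CompTree ℝ`, to which all
of `ComputationalTree.lean` applies. The model is (model:second) of §1.2 — roundoffs
`δ_1, δ_2, …` "labeled in a linear order consistent with the partial order of the underlying
algorithm", zero-mean and mean-independent, `E(δ_k | δ_1, …, δ_{k−1}) = 0`, with `|δ_k| ≤ u` —
typed as `ConnollyHighamMary2021.SRErrorModel μ u δ` (measurable, `|δ_k| ≤ u` surely,
`∫ g(δ_0, …, δ_{k−1}) δ_k dμ = 0` for bounded measurable `g`). `WellLabeled T` says the labels
increase towards the root (children are computed before their parent, `j ≺ k ⇒ j < k`) and are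
pairwise distinct (distinct additions commit distinct roundoffs) — exactly the quoted labelling
condition, and what makes `Z_i = Σ_{j≤i} (s_j + f_j) δ_j` a martingale with respect to
`δ_1, δ_2, …` (HI §2.2, proofs of Lemma 11 / Theorem 12).

## Contents

* `STree`, `inst`, `WellLabeled`, `ntilde` (`ñ`), `numInputs` (`n`), `height`, `sumSq` (`Σ s_k²`),
  `absInputs` (`Σ |x_k|`); the F-recursion `Psi c T = Σ_{j ∈ T} (|s_j| + F_j)²`,
  `Fb c T = F_root = c (Σ_{j ≺ root} (|s_j| + F_j)²)^{1/2}` with `c = λ u`; `lam m η = √(2 ln(2m/η))`;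
  `phi`.
* the coefficient process `coef v T i` (`= s_i + f_i` at the node labelled `i`) with
  `err_inst_eq_transform` (`e = Σ_i coef_i δ_i`, HI Lemma 9 in martingale-transform form), its
  predictability `isPredictable_coef`, and the sure bounds `|coef_i| ≤ |s_i| + F_i` OFF the failure
  event `FailF` ("some `|f_k| > F_k`").
* LEMMA 11 `measure_failF_le_eta`: `μ {some |f_k| > F_{k,ñ,η}} ≤ η`.
* THEOREM 12 `errBound_recursive`, COROLLARY 13 `errBound_recursive_numInputs`.
* the deterministic closed form: `sqrt_Psi_le_binomial` (eq. (eqn:model2binomials)),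
  `binomialSum_le_one_add_phi`, `sqrt_Psi_le_closedForm`; THEOREM 15 `errBound_closedForm`,
  COROLLARY 17 `errBound_closedForm_numInputs`.

## Typing notes (read before citing)

* Probabilities as in `MartingaleBounds.lean`: `μ {ω | bound < |e ω|} ≤ ENNReal.ofReal (δ + η)`;
  HI's probability parameter `δ` is called `p` here (the letter `δ` is the roundoff sequence).
  HI assume `0 < η < 1`, `0 < δ < 1 − η` (so that the statement is not vacuous); only `0 < η`,
  `0 < p` are needed and assumed.
* Theorem 15's parenthetical "ñ the number of nodes with two non-leaf children" is read as Lemma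
  11's DEFINITION `ñ = n − L − 1` = the number of nodes with AT LEAST ONE non-leaf child, which is
  the quantity its proof (via Lemma 11 and Theorem 12) uses; `ntilde` is that number.
* When `ñ = 0` (at most one addition) all child-errors vanish and the failure event is empty; Lean's
  `Real.log 0 = 0` makes `λ_{0,η} = 0`, and every statement holds as typed.
* Corollary 13's second line (`= u √(2 ln(2/δ)) (Σ s_k²)^{1/2} + O(u²)`) is asymptotic bookkeeping
  and is not typed; Theorem 15 is its quantitative form.
* NOT formalised here: §3 (shifted summation, Theorem 18), §4.2–4.3 (compensated summation,
  Theorems 20–23), §5 (mixed precision, Theorem 25 / FABsum corollary), §6 (experiments).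
-/

namespace Literature.ComputerArithmetic.HallmanIpsen2023

open MeasureTheory ProbabilityTheory Finset Real
open scoped NNReal ENNReal

open Literature.ComputerArithmetic.ConnollyHighamMary2021 (SRErrorModel)

/-! ### Summation trees with roundoff labels -/

/-- A SUMMATION TREE: the shape of a summation algorithm with the (exactly stored) inputs `x_j` at
the leaves and, at every node, the index `k` of the roundoff `δ_k` committed by that addition
(Hallman–Ipsen number the nodes `2, …, n` in the order Algorithm (alg:sum) "General summation"
computes them). [cite: HallmanIpsen2023, §2, Algorithm (alg:sum) "General summation" and
Definition "Computational tree" (Def. 4 of the arXiv text): vertex `k` carries `s_k = x + y` and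
the roundoff `δ_k`] -/
inductive STree : Type where
  | leaf (x : ℝ) : STree
  | node (k : ℕ) (l r : STree) : STree

namespace STree

/-- The computational tree REALISED by the roundoff values `v : ℕ → ℝ` (`v k = δ_k(ω)`): the node
labelled `k` commits the relative error `v k`. [cite: HallmanIpsen2023, §2, Definition
"Computational tree" (Def. 4 of the arXiv text); §1.2 eq. (model:second)] -/
def inst (v : ℕ → ℝ) : STree → CompTree ℝ
  | leaf x => CompTree.leaf x
  | node k l r => CompTree.node (v k) (inst v l) (inst v r)

/-- The exact partial sum `s_k` at the root (independent of the roundoffs).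
[cite: HallmanIpsen2023, §2, "Denote by s_k the exact partial sum"] -/
def exactVal : STree → ℝ
  | leaf x => x
  | node _ l r => exactVal l + exactVal r

/-- Height `h` of the tree. [cite: HallmanIpsen2023, §2, Definition "Computational tree"] -/
def height : STree → ℕ
  | leaf _ => 0
  | node _ l r => max (height l) (height r) + 1

/-- The number `n` of inputs (leaves). [cite: HallmanIpsen2023, §2, Algorithm (alg:sum) "General
summation" (`n` inputs, `n − 1` additions)] -/
def numInputs : STree → ℕ
  | leaf _ => 1
  | node _ l r => numInputs l + numInputs r

/-- `Σ_k |x_k|`. [cite: HallmanIpsen2023, §2, Lemma "Relation between partial sums and inputs"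
(Lem. 5 of the arXiv text)] -/
def absInputs : STree → ℝ
  | leaf x => |x|
  | node _ l r => absInputs l + absInputs r

/-- `Σ_{k=2}^n s_k²`, the sum of the squares of the exact partial sums (one per node).
[cite: HallmanIpsen2023, §2.2, Theorem 15 (thm:model2Analysis), `Σ_k s_k²`] -/
def sumSq : STree → ℝ
  | leaf _ => 0
  | node _ l r => (exactVal l + exactVal r) ^ 2 + sumSq l + sumSq r

/-- Is this (sub)tree a single input? [cite: HallmanIpsen2023, §2.2, Lemma 11 ("nodes whose
children are both leaves")] -/
def isLeaf : STree → Bool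
  | leaf _ => true
  | node _ _ _ => false

/-- `ñ = n − L − 1`: the number of nodes with AT LEAST ONE non-leaf child (`L` = the number of
nodes both of whose children are leaves). [cite: HallmanIpsen2023, §2.2, Lemma 11
(lemma:fBound of the arXiv text), definition of `ñ`] -/
def ntilde : STree → ℕ
  | leaf _ => 0
  | node _ l r => (if (l.isLeaf && r.isLeaf) = true then 0 else 1) + ntilde l + ntilde r

/-- The set of roundoff labels (node indices) occurring in the tree.
[cite: HallmanIpsen2023, §2, Definition "Computational tree" (nodes `2, …, n`)] -/
def labels : STree → Finset ℕ
  | leaf _ => ∅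
  | node k l r => insert k (labels l ∪ labels r)

/-- WELL-LABELLED trees: the children of every node carry smaller labels than the node (they are
computed first: `j ≺ k ⇒ j < k` — "Algorithm (alg:sum) imposes a topological ordering on the
graph: `j ≺ k` implies that `j < k`"), and distinct nodes carry distinct labels (distinct additions
commit distinct roundoffs) — the roundoffs are "labeled in a linear order consistent with the
partial order of the underlying algorithm". This is what makes `Z_i = Σ_{j ≤ i} (s_j + f_j) δ_j` a
martingale with respect to `δ_1, …, δ_n`. [cite: HallmanIpsen2023, §2, the paragraph after
Definition 4 ("imposes a topological ordering … `j ≺ k` implies that `j < k`"); §1.2, "Probabilistic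
model for sequences of roundoffs" (the sentence before eq. (model:second)); §2.2, proofs of
Lemma 11 and Theorem 12 ("is a martingale with respect to `δ_1, …, δ_{k−1}`")] -/
def WellLabeled : STree → Prop
  | leaf _ => True
  | node k l r => WellLabeled l ∧ WellLabeled r ∧ (∀ j ∈ labels l, j < k) ∧
      (∀ j ∈ labels r, j < k) ∧ Disjoint (labels l) (labels r)

section Transport

variable (v : ℕ → ℝ)

/-- [folklore] unfolding `inst` at a leaf. -/
@[simp] private theorem inst_leaf (x : ℝ) : (leaf x).inst v = CompTree.leaf x := rfl

/-- [folklore] unfolding `inst` at a node. -/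
@[simp] private theorem inst_node (k : ℕ) (l r : STree) :
    (node k l r).inst v = CompTree.node (v k) (l.inst v) (r.inst v) := rfl

/-- The exact partial sums do not depend on the roundoffs: `(T.inst v).exact = T.exactVal`.
[cite: HallmanIpsen2023, §2, "Denote by s_k the exact partial sum"] -/
@[simp] theorem exact_inst : ∀ T : STree, (T.inst v).exact = T.exactVal
  | leaf x => rfl
  | node k l r => by simp only [inst_node, CompTree.exact, exactVal, exact_inst l, exact_inst r]

/-- `(T.inst v).height = T.height`. [cite: HallmanIpsen2023, §2, Definition "Computational tree"] -/
@[simp] theorem height_inst : ∀ T : STree, (T.inst v).height = T.height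
  | leaf x => rfl
  | node k l r => by simp only [inst_node, CompTree.height, height, height_inst l, height_inst r]

/-- `(T.inst v).absInputs = T.absInputs`. [cite: HallmanIpsen2023, §2, Lemma 5] -/
@[simp] theorem absInputs_inst : ∀ T : STree, (T.inst v).absInputs = T.absInputs
  | leaf x => rfl
  | node k l r => by
      simp only [inst_node, CompTree.absInputs, absInputs, absInputs_inst l, absInputs_inst r]

/-- `(T.inst v).sumSqPartial = T.sumSq`. [cite: HallmanIpsen2023, §2, Lemma 5] -/
@[simp] theorem sumSqPartial_inst : ∀ T : STree, (T.inst v).sumSqPartial = T.sumSq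
  | leaf x => rfl
  | node k l r => by
      simp only [inst_node, CompTree.sumSqPartial, sumSq, exact_inst, sumSqPartial_inst l,
        sumSqPartial_inst r]

/-- A leaf (an input) carries no error. [cite: HallmanIpsen2023, §2.1, proof of Lemma 9
("e_x = e_y = 0 if x and y are inputs")] -/
@[simp] theorem err_inst_leaf (x : ℝ) : ((leaf x).inst v).err = 0 := by simp

/-- The child-error of a node is the sum of the errors of its two computed children:
`f_k = e_x + e_y`. [cite: HallmanIpsen2023, §2.1, Lemma 9 (lemma:forwardErrorRec), "f_k is equal
to the sum of the errors in the computed children"] -/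
theorem childErr_inst_node (k : ℕ) (l r : STree) :
    ((node k l r).inst v).childErr = (l.inst v).err + (r.inst v).err := by
  simp [CompTree.childErr]

/-- Error propagation through the node labelled `k`: `e_k = f_k + (s_k + f_k) δ_k`.
[cite: HallmanIpsen2023, §2.1, proof of Lemma 9, display `e_k = f_k + (s_k + f_k) δ_k`] -/
theorem err_inst_node (k : ℕ) (l r : STree) :
    ((node k l r).inst v).err = ((l.inst v).err + (r.inst v).err)
      + (exactVal l + exactVal r + ((l.inst v).err + (r.inst v).err)) * v k := by
  rw [inst_node, CompTree.err_node_eq_childErr]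
  simp [CompTree.childErr, CompTree.exact]

/-- `Σ s_k² ≤ h (Σ |x_k|)²` (HI Lemma 5, transported). [cite: HallmanIpsen2023, §2, Lemma 5
(second inequality)] -/
theorem sumSq_le_height_mul_sq (T : STree) : T.sumSq ≤ (T.height : ℝ) * T.absInputs ^ 2 := by
  have h := CompTree.sumSqPartial_le (T.inst fun _ => 0)
  simpa using h

end Transport

/-- `0 ≤ Σ s_k²`. [cite: HallmanIpsen2023, §2.2, Theorem 15] -/
theorem sumSq_nonneg : ∀ T : STree, 0 ≤ T.sumSq
  | leaf _ => le_rfl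
  | node _ l r => by
      simp only [sumSq]; have := sumSq_nonneg l; have := sumSq_nonneg r; positivity

/-- `0 ≤ Σ |x_k|`. [cite: HallmanIpsen2023, §2, Lemma 5] -/
theorem absInputs_nonneg : ∀ T : STree, 0 ≤ T.absInputs
  | leaf x => abs_nonneg x
  | node _ l r => add_nonneg (absInputs_nonneg l) (absInputs_nonneg r)

/-- [folklore] a tree with `isLeaf = true` is a leaf. -/
private theorem exists_eq_leaf_of_isLeaf : ∀ {T : STree}, T.isLeaf = true → ∃ x, T = leaf x
  | leaf x, _ => ⟨x, rfl⟩
  | node _ _ _, h => by simp [isLeaf] at h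

/-- `ñ < n`: there are fewer nodes with a non-leaf child than inputs.
[cite: HallmanIpsen2023, §2.2, Lemma 11 (`ñ = n − L − 1`)] -/
theorem ntilde_lt_numInputs : ∀ T : STree, T.ntilde < T.numInputs
  | leaf _ => by simp [ntilde, numInputs]
  | node _ l r => by
      have hl := ntilde_lt_numInputs l
      have hr := ntilde_lt_numInputs r
      simp only [ntilde, numInputs]
      split_ifs <;> omega

/-! ### The F-recursion (HI eq. (eqn:FBoundRecurrence)) -/

/-- `Ψ_c(T) = Σ_{j ∈ nodes(T)} (|s_j| + F_j)²`, where the F-BOUNDS are defined down the tree by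
`F_j = c (Σ_{i ≺ j} (|s_i| + F_i)²)^{1/2}` (so `F_j = 0` at a node with two leaf children); with
`c = λ_{ñ,η} u` these are Hallman–Ipsen's `F_{j,ñ,η}`, and `Ψ` of the whole tree is the radicand of
Theorem 12. [cite: HallmanIpsen2023, §2.2, Lemma 11, eq. (eqn:FBoundRecurrence); Theorem 12,
eq. (eqn:model2errBound)] -/
noncomputable def Psi (c : ℝ) : STree → ℝ
  | leaf _ => 0
  | node _ l r => (|exactVal l + exactVal r| + c * Real.sqrt (Psi c l + Psi c r)) ^ 2
      + Psi c l + Psi c r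

/-- The F-bound of the ROOT node: `F_k = c (Σ_{j ≺ k} (|s_j| + F_j)²)^{1/2}` (`0` at a leaf and at a
node with two leaf children). [cite: HallmanIpsen2023, §2.2, Lemma 11, eq. (eqn:FBoundRecurrence)] -/
noncomputable def Fb (c : ℝ) : STree → ℝ
  | leaf _ => 0
  | node _ l r => c * Real.sqrt (Psi c l + Psi c r)

/-- `λ_{m,η} = √(2 ln(2m/η))`. [cite: HallmanIpsen2023, §2.2, Lemma 11 (`λ_{ñ,η}`), Corollary 13
(`λ_{n,η}`)] -/
noncomputable def lam (m : ℕ) (η : ℝ) : ℝ := Real.sqrt (2 * Real.log (2 * m / η))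

/-- `φ_{·,h,η} = λ √(2h) u exp(λ² h u²)`. [cite: HallmanIpsen2023, §2.2, Theorem 15,
eq. (eqn:lnlh)] -/
noncomputable def phi (lam' : ℝ) (h : ℕ) (u : ℝ) : ℝ :=
  lam' * Real.sqrt (2 * h) * u * Real.exp (lam' ^ 2 * h * u ^ 2)

/-- `0 ≤ Ψ`. [cite: HallmanIpsen2023, §2.2, Lemma 11] -/
theorem Psi_nonneg (c : ℝ) : ∀ T : STree, 0 ≤ Psi c T
  | leaf _ => le_rfl
  | node _ l r => by
      simp only [Psi]; have := Psi_nonneg c l; have := Psi_nonneg c r; positivity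

/-- `0 ≤ F_k` for `c ≥ 0`. [cite: HallmanIpsen2023, §2.2, Lemma 11] -/
theorem Fb_nonneg {c : ℝ} (hc : 0 ≤ c) : ∀ T : STree, 0 ≤ Fb c T
  | leaf _ => le_rfl
  | node _ _ _ => mul_nonneg hc (Real.sqrt_nonneg _)

/-- `Ψ(node) = (|s_k| + F_k)² + Ψ(l) + Ψ(r)`. [cite: HallmanIpsen2023, §2.2, Lemma 11,
eq. (eqn:FBoundRecurrence)] -/
theorem Psi_node (c : ℝ) (k : ℕ) (l r : STree) :
    Psi c (node k l r) = (|exactVal l + exactVal r| + Fb c (node k l r)) ^ 2 + Psi c l + Psi c r :=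
  rfl

/-- `Ψ_c` is monotone in `c ≥ 0` (used for Corollary 13: `λ_{n,η} ≥ λ_{ñ,η}`).
[cite: HallmanIpsen2023, §2.2, Corollary 13] -/
theorem Psi_mono {c c' : ℝ} (hc : 0 ≤ c) (hcc' : c ≤ c') : ∀ T : STree, Psi c T ≤ Psi c' T
  | leaf _ => le_rfl
  | node _ l r => by
      have hl := Psi_mono hc hcc' l
      have hr := Psi_mono hc hcc' r
      have h0 := Psi_nonneg c l
      have h0' := Psi_nonneg c r
      simp only [Psi]
      have h1 : |exactVal l + exactVal r| + c * Real.sqrt (Psi c l + Psi c r)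
          ≤ |exactVal l + exactVal r| + c' * Real.sqrt (Psi c' l + Psi c' r) := by
        have := Real.sqrt_le_sqrt (add_le_add hl hr)
        have := Real.sqrt_nonneg (Psi c l + Psi c r)
        nlinarith
      have h2 : 0 ≤ |exactVal l + exactVal r| + c * Real.sqrt (Psi c l + Psi c r) := by positivity
      nlinarith [mul_self_le_mul_self h2 h1]

/-- `0 ≤ λ_{m,η}`. [cite: HallmanIpsen2023, §2.2, Lemma 11] -/
theorem lam_nonneg (m : ℕ) (η : ℝ) : 0 ≤ lam m η := Real.sqrt_nonneg _

/-- `λ_{m,η} ≤ λ_{m',η}` for `m ≤ m'`. [cite: HallmanIpsen2023, §2.2, Corollary 13 / Corollary 17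
(the bounds with `n` in place of `ñ`)] -/
theorem lam_mono {m m' : ℕ} (hmm' : m ≤ m') {η : ℝ} (hη : 0 < η) : lam m η ≤ lam m' η := by
  unfold lam
  rcases Nat.eq_zero_or_pos m with hm | hm
  · subst hm; simp [Real.sqrt_nonneg]
  · refine Real.sqrt_le_sqrt (mul_le_mul_of_nonneg_left (Real.log_le_log (by positivity) ?_)
      (by norm_num))
    gcongr

/-- `0 ≤ φ`. [cite: HallmanIpsen2023, §2.2, Theorem 15] -/
theorem phi_nonneg {lam' u : ℝ} (hl : 0 ≤ lam') (hu : 0 ≤ u) (h : ℕ) : 0 ≤ phi lam' h u := by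
  unfold phi; positivity

/-! ### The error as a martingale transform of the roundoffs -/

/-- The COEFFICIENT PROCESS of the error martingale: `coef v T i = s_i + f_i` if `i` labels a node
of `T` (exact partial sum plus child-error of that node), `0` otherwise; so that
`e = Σ_i coef_i δ_i` and, for the node `k` with children `l, r`, `f_k = Σ_{i<k} (coef l + coef r)_i δ_i`.
[cite: HallmanIpsen2023, §2.1, Lemma 9 (`e_n = Σ_j (s_j + f_j) δ_j`, `f_k = Σ_{j≺k} (s_j + f_j) δ_j`);
§2.2, proof of Theorem 12 (`Z_i = Σ_{j≤i} (s_j + f_j) δ_j`)] -/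
noncomputable def coef (v : ℕ → ℝ) : STree → ℕ → ℝ
  | leaf _, _ => 0
  | node k l r, i => (if i = k then exactVal l + exactVal r + ((l.inst v).err + (r.inst v).err)
      else 0) + coef v l i + coef v r i

/-- The CANDIDATE BOUNDS of the coefficient process: `|s_i| + F_i` at the node labelled `i`.
[cite: HallmanIpsen2023, §2.2, proofs of Lemma 11 and Theorem 12
(`|Z_i − Z_{i−1}| ≤ u(|s_i| + F_{i,ñ,η})`)] -/
noncomputable def coefBound (c : ℝ) : STree → ℕ → ℝ
  | leaf _, _ => 0
  | node k l r, i => (if i = k then |exactVal l + exactVal r| + Fb c (node k l r) else 0)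
      + coefBound c l i + coefBound c r i

/-- The FAILURE EVENT of Lemma 11: some node `k` of the tree has `|f_k| > F_k`.
[cite: HallmanIpsen2023, §2.2, Lemma 11 (the complement of "`|f_k| ≤ F_{k,ñ,η}`, `2 ≤ k ≤ n`")] -/
def FailF (c : ℝ) (v : ℕ → ℝ) : STree → Prop
  | leaf _ => False
  | node k l r => Fb c (node k l r) < |(l.inst v).err + (r.inst v).err| ∨ FailF c v l ∨ FailF c v r

section Coef

variable (v : ℕ → ℝ)

/-- [folklore] the computed value depends only on the roundoffs at the tree's own labels. -/
private theorem comp_inst_congr {v w : ℕ → ℝ} :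
    ∀ T : STree, (∀ j ∈ T.labels, v j = w j) → (T.inst v).comp = (T.inst w).comp
  | leaf x, _ => rfl
  | node k l r, h => by
      simp only [labels, Finset.mem_insert, Finset.mem_union] at h
      have hk : v k = w k := h k (Or.inl rfl)
      have hl := comp_inst_congr l (fun j hj => h j (Or.inr (Or.inl hj)))
      have hr := comp_inst_congr r (fun j hj => h j (Or.inr (Or.inr hj)))
      simp only [inst_node, CompTree.comp, hk, hl, hr]

/-- The error of a (sub)tree depends only on the roundoffs committed inside it.
[cite: HallmanIpsen2023, §2.1, Lemma 9 (`f_k` is a sum over the descendants `j ≺ k`)] -/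
theorem err_inst_congr {v w : ℕ → ℝ} (T : STree) (h : ∀ j ∈ T.labels, v j = w j) :
    (T.inst v).err = (T.inst w).err := by
  simp only [CompTree.err, comp_inst_congr T h, exact_inst]

/-- [folklore] the computed value is a measurable function of the roundoff sequence. -/
private theorem measurable_comp_inst : ∀ T : STree, Measurable (fun v : ℕ → ℝ => (T.inst v).comp)
  | leaf x => measurable_const
  | node k l r => by
      show Measurable (fun v : ℕ → ℝ => ((l.inst v).comp + (r.inst v).comp) * (1 + v k))
      exact ((measurable_comp_inst l).add (measurable_comp_inst r)).mul
        (measurable_const.add (measurable_pi_apply k))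

/-- The error is a measurable function of the roundoff sequence (a random variable).
[cite: HallmanIpsen2023, §1.2, eq. (model:second) (roundoffs as random variables)] -/
theorem measurable_err_inst (T : STree) : Measurable (fun v : ℕ → ℝ => (T.inst v).err) := by
  have : (fun v : ℕ → ℝ => (T.inst v).err) = fun v => (T.inst v).comp - T.exactVal := by
    funext v; simp [CompTree.err]
  rw [this]
  exact (measurable_comp_inst T).sub measurable_const

/-- [folklore] the coefficient process is a measurable function of the roundoff sequence. -/
private theorem measurable_coef (i : ℕ) : ∀ T : STree, Measurable (fun v : ℕ → ℝ => coef v T i)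
  | leaf x => by
      show Measurable (fun _ : ℕ → ℝ => (0 : ℝ))
      exact measurable_const
  | node k l r => by
      have hite : Measurable (fun v : ℕ → ℝ => if i = k then
          exactVal l + exactVal r + ((l.inst v).err + (r.inst v).err) else 0) := by
        by_cases hik : i = k
        · simp only [if_pos hik]
          exact measurable_const.add ((measurable_err_inst l).add (measurable_err_inst r))
        · simp only [if_neg hik]; exact measurable_const
      show Measurable (fun v : ℕ → ℝ => (if i = k then
          exactVal l + exactVal r + ((l.inst v).err + (r.inst v).err) else 0)
        + coef v l i + coef v r i)
      exact (hite.add (measurable_coef i l)).add (measurable_coef i r)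

/-- [folklore] coefficients vanish off the tree's labels. -/
private theorem coef_eq_zero {i : ℕ} : ∀ T : STree, i ∉ T.labels → coef v T i = 0
  | leaf _, _ => rfl
  | node k l r, h => by
      simp only [labels, Finset.mem_insert, Finset.mem_union, not_or] at h
      simp [coef, h.1, coef_eq_zero l h.2.1, coef_eq_zero r h.2.2]

/-- [folklore] candidate bounds vanish off the tree's labels. -/
private theorem coefBound_eq_zero (c : ℝ) {i : ℕ} : ∀ T : STree, i ∉ T.labels → coefBound c T i = 0
  | leaf _, _ => rfl
  | node k l r, h => by
      simp only [labels, Finset.mem_insert, Finset.mem_union, not_or] at h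
      simp [coefBound, h.1, coefBound_eq_zero c l h.2.1, coefBound_eq_zero c r h.2.2]

/-- `0 ≤ |s_i| + F_i`. [cite: HallmanIpsen2023, §2.2, Lemma 11] -/
theorem coefBound_nonneg {c : ℝ} (hc : 0 ≤ c) (i : ℕ) : ∀ T : STree, 0 ≤ coefBound c T i
  | leaf _ => le_rfl
  | node k l r => by
      simp only [coefBound]
      refine add_nonneg (add_nonneg ?_ (coefBound_nonneg hc i l)) (coefBound_nonneg hc i r)
      split_ifs
      · exact add_nonneg (abs_nonneg _) (Fb_nonneg hc _)
      · exact le_rfl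

/-- **The error as a martingale transform (HI Lemma 9 in coefficient form).** If every label of
`T` is `< N` then `e = Σ_{i<N} coef_i δ_i`. [cite: HallmanIpsen2023, §2.1, Lemma 9 (second
explicit expression `e_n = Σ_{j=2}^n (s_j + f_j) δ_j`); §2.2, proof of Theorem 12] -/
theorem err_inst_eq_sum {N : ℕ} : ∀ T : STree, (∀ j ∈ T.labels, j < N) →
    (T.inst v).err = ∑ i ∈ range N, coef v T i * v i
  | leaf x, _ => by simp [coef]
  | node k l r, h => by
      simp only [labels, Finset.mem_insert, Finset.mem_union] at h
      have hk : k < N := h k (Or.inl rfl)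
      have hl := err_inst_eq_sum l (fun j hj => h j (Or.inr (Or.inl hj)))
      have hr := err_inst_eq_sum r (fun j hj => h j (Or.inr (Or.inr hj)))
      rw [err_inst_node]
      simp only [coef, add_mul, sum_add_distrib, ite_mul, zero_mul]
      rw [Finset.sum_ite_eq' (range N) k, if_pos (mem_range.mpr hk), ← hl, ← hr]
      ring

/-- **The child-error as a martingale transform**: for the node `k` with children `l, r` (labels
`< k`), `f_k = e_l + e_r = Σ_{i<k} (coef l + coef r)_i δ_i` (HI eq. (eqn:frecurrence)).
[cite: HallmanIpsen2023, §2.1, Lemma 9, eq. (eqn:frecurrence); §2.2, proof of Lemma 11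
(`Z_i = Σ_{j≤i} (s_j + f_j) δ_j 1_{j≺k}`, `f_k = Z_{k−1} − Z_1`)] -/
theorem childErr_eq_sum {k : ℕ} {l r : STree} (hl : ∀ j ∈ l.labels, j < k)
    (hr : ∀ j ∈ r.labels, j < k) :
    (l.inst v).err + (r.inst v).err = ∑ i ∈ range k, (coef v l i + coef v r i) * v i := by
  rw [err_inst_eq_sum v l hl, err_inst_eq_sum v r hr, ← sum_add_distrib]
  exact sum_congr rfl (fun i _ => by ring)

/-- **Sure increment bounds off the failure event**: if no node of `T` has `|f_j| > F_j`, then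
`|coef_i| ≤ |s_i| + F_i` for every `i`. [cite: HallmanIpsen2023, §2.2, proofs of Lemma 11 and
Theorem 12 (`|Z_i − Z_{i−1}| = |(s_i + f_i) δ_i| ≤ u(|s_i| + F_{i,ñ,η})`)] -/
theorem abs_coef_le_coefBound {c : ℝ} (hc : 0 ≤ c) (i : ℕ) :
    ∀ T : STree, ¬ FailF c v T → |coef v T i| ≤ coefBound c T i
  | leaf _, _ => by simp [coef, coefBound]
  | node k l r, h => by
      simp only [FailF, not_or, not_lt] at h
      obtain ⟨hroot, hl, hr⟩ := h
      have ihl := abs_coef_le_coefBound hc i l hl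
      have ihr := abs_coef_le_coefBound hc i r hr
      simp only [coef, coefBound]
      refine (abs_add_le _ _).trans (add_le_add ((abs_add_le _ _).trans (add_le_add ?_ ihl)) ihr)
      split_ifs
      · exact (abs_add_le _ _).trans (add_le_add le_rfl hroot)
      · simp

/-- **The variance of the increments is `Ψ`**: for a well-labelled tree with labels `< N`,
`Σ_{i<N} (|s_i| + F_i)² = Ψ_c(T)` (distinct nodes carry distinct labels).
[cite: HallmanIpsen2023, §2.2, Lemma 11 / Theorem 12 (the radicands `Σ_{j≺k} (|s_j| + F_j)²`,
`Σ_{j=2}^n (|s_j| + F_j)²`)] -/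
theorem sum_sq_coefBound (c : ℝ) {N : ℕ} : ∀ T : STree, T.WellLabeled → (∀ j ∈ T.labels, j < N) →
    ∑ i ∈ range N, coefBound c T i ^ 2 = Psi c T
  | leaf x, _, _ => by simp [coefBound, Psi]
  | node k l r, hW, h => by
      obtain ⟨hWl, hWr, hkl, hkr, hdisj⟩ := hW
      simp only [labels, Finset.mem_insert, Finset.mem_union] at h
      have hk : k < N := h k (Or.inl rfl)
      have ihl := sum_sq_coefBound c l hWl (fun j hj => h j (Or.inr (Or.inl hj)))
      have ihr := sum_sq_coefBound c r hWr (fun j hj => h j (Or.inr (Or.inr hj)))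
      have hkl' : k ∉ l.labels := fun hm => lt_irrefl k (hkl k hm)
      have hkr' : k ∉ r.labels := fun hm => lt_irrefl k (hkr k hm)
      -- pointwise, at most one of the three summands is nonzero
      have hpt : ∀ i, coefBound c (node k l r) i ^ 2 =
          (if i = k then (|exactVal l + exactVal r| + Fb c (node k l r)) ^ 2 else 0)
            + coefBound c l i ^ 2 + coefBound c r i ^ 2 := by
        intro i
        simp only [coefBound]
        by_cases hik : i = k
        · subst hik
          simp [coefBound_eq_zero c l hkl', coefBound_eq_zero c r hkr']
        · simp only [if_neg hik, zero_add]
          by_cases hil : i ∈ l.labels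
          · have hir : i ∉ r.labels := Finset.disjoint_left.mp hdisj hil
            simp [coefBound_eq_zero c r hir]
          · simp [coefBound_eq_zero c l hil]
      simp only [hpt, sum_add_distrib, ihl, ihr, Finset.sum_ite_eq' (range N) k,
        if_pos (mem_range.mpr hk), Psi_node]

/-- **Predictability of the coefficients**: in a well-labelled tree `coef_i` depends only on the
roundoffs `δ_j`, `j < i` (the child-error of node `i` is committed below it).
[cite: HallmanIpsen2023, §2.2, proofs of Lemma 11 / Theorem 12 ("martingale with respect to
`δ_1, …, δ_{k−1}`")] -/
theorem coef_congr {v w : ℕ → ℝ} (i : ℕ) : ∀ T : STree, T.WellLabeled → (∀ j < i, v j = w j) →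
    coef v T i = coef w T i
  | leaf _, _, _ => rfl
  | node k l r, hW, h => by
      obtain ⟨hWl, hWr, hkl, hkr, -⟩ := hW
      have ihl := coef_congr i l hWl h
      have ihr := coef_congr i r hWr h
      simp only [coef, ihl, ihr]
      by_cases hik : i = k
      · subst hik
        rw [err_inst_congr l (fun j hj => h j (hkl j hj)), err_inst_congr r (fun j hj => h j (hkr j hj))]
      · simp only [if_neg hik]

end Coef

/-! ### LEMMA 11: all child-errors are bounded simultaneously, with probability `≥ 1 − η` -/

section Probabilistic

variable {Ω : Type*} [MeasurableSpace Ω] {μ : Measure Ω} {u : ℝ} {δ : ℕ → Ω → ℝ}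

omit [MeasurableSpace Ω] in
/-- The coefficient process of a well-labelled tree is PREDICTABLE with respect to the roundoffs.
[cite: HallmanIpsen2023, §2.2, proof of Theorem 12 ("`Z_i` is a martingale with respect to
`δ_1, …, δ_n`")] -/
theorem isPredictable_coef {T : STree} (hT : T.WellLabeled) :
    IsPredictable δ (fun i ω => coef (fun j => δ j ω) T i) := fun i =>
  ⟨fun v => coef v T i, measurable_coef i T, fun _ _ hvw => coef_congr i T hT
    (fun j hj => hvw j (Set.mem_Iio.mpr hj)), fun _ => rfl⟩

omit [MeasurableSpace Ω] in
/-- The coefficient process of the CHILD-ERROR martingale of a node (the two subtrees together) is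
predictable. [cite: HallmanIpsen2023, §2.2, proof of Lemma 11 ("is a martingale with respect to
`δ_1, …, δ_{k−1}`")] -/
theorem isPredictable_coef_pair {l r : STree} (hl : l.WellLabeled) (hr : r.WellLabeled) :
    IsPredictable δ (fun i ω => coef (fun j => δ j ω) l i + coef (fun j => δ j ω) r i) := fun i =>
  ⟨fun v => coef v l i + coef v r i, (measurable_coef i l).add (measurable_coef i r),
    fun _ _ hvw => congrArg₂ (· + ·) (coef_congr i l hl (fun j hj => hvw j (Set.mem_Iio.mpr hj)))
      (coef_congr i r hr (fun j hj => hvw j (Set.mem_Iio.mpr hj))),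
    fun _ => rfl⟩

variable [IsProbabilityMeasure μ]

/-- [folklore] `√(u² x) = u √x` for `u ≥ 0`. -/
private theorem sqrt_sq_mul {u x : ℝ} (hu : 0 ≤ u) : Real.sqrt (u ^ 2 * x) = u * Real.sqrt x := by
  rw [Real.sqrt_mul (sq_nonneg u), Real.sqrt_sq hu]

/-- **The Azuma step at one node (induction step of HI Lemma 11).** For the node `k` with children
`l, r` of a well-labelled tree and `c = √(2 ln(2/p)) u`: the event "`|f_k| > F_k` although no
child-error below `k` failed its bound" has probability at most `p` — Lemma 2 applied to the
martingale `Z_i = Σ_{j≤i, j≺k} (s_j + f_j) δ_j` whose increments obey `|Z_i − Z_{i−1}| ≤ u(|s_i| + F_i)`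
off the failure event. [cite: HallmanIpsen2023, §2.2, Lemma 11, proof (induction step, "setting
`δ = η/ñ`, Lemma (l_azuma) implies …")] -/
theorem measure_rootFail_le (h : SRErrorModel μ u δ) {k : ℕ} {l r : STree}
    (hW : (node k l r).WellLabeled) {p c : ℝ} (hp : 0 < p)
    (hc : c = Real.sqrt (2 * Real.log (2 / p)) * u) :
    μ {ω | Fb c (node k l r) < |(l.inst fun j => δ j ω).err + (r.inst fun j => δ j ω).err|
        ∧ ¬ FailF c (fun j => δ j ω) l ∧ ¬ FailF c (fun j => δ j ω) r} ≤ ENNReal.ofReal p := by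
  obtain ⟨hWl, hWr, hkl, hkr, hdisj⟩ := hW
  have hu : 0 ≤ u := u_nonneg h
  have hc0 : 0 ≤ c := by rw [hc]; positivity
  set a : ℕ → Ω → ℝ := fun i ω => coef (fun j => δ j ω) l i + coef (fun j => δ j ω) r i with ha
  set A : ℕ → ℝ := fun i => coefBound c l i + coefBound c r i with hA
  have hP : IsPredictable δ a := isPredictable_coef_pair hWl hWr
  have hA0 : ∀ i, 0 ≤ A i := fun i => add_nonneg (coefBound_nonneg hc0 i l) (coefBound_nonneg hc0 i r)
  -- the variance proxy: `Σ_{i<k} (A_i u)² = u² (Ψ l + Ψ r)` (distinct labels)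
  have hvar : ∑ i ∈ range k, (A i * u) ^ 2 = u ^ 2 * (Psi c l + Psi c r) := by
    have hcross : ∀ i, coefBound c l i * coefBound c r i = 0 := by
      intro i
      by_cases hil : i ∈ l.labels
      · rw [coefBound_eq_zero c r (Finset.disjoint_left.mp hdisj hil), mul_zero]
      · rw [coefBound_eq_zero c l hil, zero_mul]
    have hsq : ∀ i, A i ^ 2 = coefBound c l i ^ 2 + coefBound c r i ^ 2 := by
      intro i; simp only [hA]; nlinarith [hcross i]
    calc ∑ i ∈ range k, (A i * u) ^ 2 = u ^ 2 * ∑ i ∈ range k, A i ^ 2 := by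
          rw [mul_sum]; exact sum_congr rfl (fun i _ => by ring)
      _ = u ^ 2 * (Psi c l + Psi c r) := by
          simp only [hsq, sum_add_distrib, sum_sq_coefBound c l hWl hkl, sum_sq_coefBound c r hWr hkr]
  have hrad : azumaRadius (∑ i ∈ range k, (A i * u) ^ 2) p = Fb c (node k l r) := by
    rw [hvar, azumaRadius, sqrt_sq_mul hu, Fb, hc]; ring
  refine (measure_mono ?_).trans (azumaHoeffding_trunc h hP hA0 k hp)
  intro ω hω
  obtain ⟨hlt, hgl, hgr⟩ := hω
  show azumaRadius (∑ i ∈ range k, (A i * u) ^ 2) p < |truncTransform a A δ k ω|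
  have hbd : ∀ i < k, |a i ω| ≤ A i := fun i _ =>
    (abs_add_le _ _).trans (add_le_add (abs_coef_le_coefBound _ hc0 i l hgl)
      (abs_coef_le_coefBound _ hc0 i r hgr))
  rw [hrad, truncTransform_eq_transform hbd, transform, ← childErr_eq_sum _ hkl hkr]
  exact hlt

/-- [folklore] no failure can occur in a tree with `ñ = 0` (every child-error vanishes). -/
private theorem not_failF_of_ntilde_eq_zero (c : ℝ) (v : ℕ → ℝ) :
    ∀ T : STree, T.ntilde = 0 → ¬ FailF c v T
  | leaf _, _ => fun hf => hf
  | node k l r, h => by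
      simp only [ntilde] at h
      by_cases hb : (l.isLeaf && r.isLeaf) = true
      · obtain ⟨x, rfl⟩ := exists_eq_leaf_of_isLeaf (Bool.and_eq_true_iff.mp hb).1
        obtain ⟨y, rfl⟩ := exists_eq_leaf_of_isLeaf (Bool.and_eq_true_iff.mp hb).2
        simp [FailF, Fb, Psi]
      · simp [hb] at h

/-- **LEMMA 11, counting form.** For a well-labelled tree, `0 < p` and `c = √(2 ln(2/p)) u`:
`μ {some node k has |f_k| > F_k} ≤ ñ · p` (union bound over the `ñ` nodes with a non-leaf child,
each contributing at most `p` by `measure_rootFail_le`; nodes with two leaf children have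
`f_k = F_k = 0`). [cite: HallmanIpsen2023, §2.2, Lemma 11, proof (induction over `k` with failure
probability `(k − L − 1) η/ñ`)] -/
theorem measure_failF_le (h : SRErrorModel μ u δ) {p c : ℝ} (hp : 0 < p)
    (hc : c = Real.sqrt (2 * Real.log (2 / p)) * u) :
    ∀ T : STree, T.WellLabeled →
      μ {ω | FailF c (fun j => δ j ω) T} ≤ (T.ntilde : ℝ≥0∞) * ENNReal.ofReal p
  | leaf _, _ => by simp [FailF]
  | node k l r, hW => by
      have ihl := measure_failF_le h hp hc l hW.1
      have ihr := measure_failF_le h hp hc r hW.2.1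
      by_cases hb : (l.isLeaf && r.isLeaf) = true
      · -- both children are inputs: `f_k = 0 = F_k`, nothing can fail
        have hnt : (node k l r).ntilde = 0 := by
          obtain ⟨x, rfl⟩ := exists_eq_leaf_of_isLeaf (Bool.and_eq_true_iff.mp hb).1
          obtain ⟨y, rfl⟩ := exists_eq_leaf_of_isLeaf (Bool.and_eq_true_iff.mp hb).2
          simp [ntilde, isLeaf]
        have hempty : {ω | FailF c (fun j => δ j ω) (node k l r)} = ∅ := by
          ext ω
          simp only [Set.mem_setOf_eq, Set.mem_empty_iff_false, iff_false]
          exact not_failF_of_ntilde_eq_zero c _ _ hnt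
        rw [hempty, measure_empty]
        exact bot_le
      · have hnt : ((node k l r).ntilde : ℝ≥0∞) = 1 + l.ntilde + r.ntilde := by
          simp [ntilde, hb]
        have hsub : {ω | FailF c (fun j => δ j ω) (node k l r)}
            ⊆ ({ω | Fb c (node k l r) < |(l.inst fun j => δ j ω).err + (r.inst fun j => δ j ω).err|
                  ∧ ¬ FailF c (fun j => δ j ω) l ∧ ¬ FailF c (fun j => δ j ω) r}
              ∪ {ω | FailF c (fun j => δ j ω) l}) ∪ {ω | FailF c (fun j => δ j ω) r} := by
          intro ω hω
          simp only [Set.mem_setOf_eq, FailF, Set.mem_union] at hω ⊢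
          tauto
        calc μ {ω | FailF c (fun j => δ j ω) (node k l r)}
            ≤ μ ({ω | Fb c (node k l r) < |(l.inst fun j => δ j ω).err + (r.inst fun j => δ j ω).err|
                  ∧ ¬ FailF c (fun j => δ j ω) l ∧ ¬ FailF c (fun j => δ j ω) r}
              ∪ {ω | FailF c (fun j => δ j ω) l}) + μ {ω | FailF c (fun j => δ j ω) r} :=
              (measure_mono hsub).trans (measure_union_le _ _)
          _ ≤ (ENNReal.ofReal p + (l.ntilde : ℝ≥0∞) * ENNReal.ofReal p)
              + (r.ntilde : ℝ≥0∞) * ENNReal.ofReal p := by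
              gcongr
              exact (measure_union_le _ _).trans
                (add_le_add (measure_rootFail_le h hW hp hc) ihl)
          _ = ((node k l r).ntilde : ℝ≥0∞) * ENNReal.ofReal p := by rw [hnt]; ring

/-- **LEMMA 11 (Hallman–Ipsen): probabilistic bounds for all child-errors simultaneously.** Under
the model (model:second), for a well-labelled summation tree and `0 < η`, with
`λ_{ñ,η} = √(2 ln(2ñ/η))` and the F-bounds `F_{k,ñ,η}` of eq. (eqn:FBoundRecurrence)
(`c = λ_{ñ,η} u`): with probability at least `1 − η`, `|f_k| ≤ F_{k,ñ,η}` for EVERY node `k`; i.e.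
`μ {some |f_k| > F_{k,ñ,η}} ≤ η`.
[cite: HallmanIpsen2023, §2.2, Lemma 11 (lemma:fBound, Lem. 11 of the arXiv text)] -/
theorem measure_failF_le_eta (h : SRErrorModel μ u δ) {T : STree} (hT : T.WellLabeled) {η : ℝ}
    (hη : 0 < η) :
    μ {ω | FailF (lam T.ntilde η * u) (fun j => δ j ω) T} ≤ ENNReal.ofReal η := by
  rcases Nat.eq_zero_or_pos T.ntilde with hn | hn
  · have hempty : {ω | FailF (lam T.ntilde η * u) (fun j => δ j ω) T} = ∅ := by
      ext ω
      simp only [Set.mem_setOf_eq, Set.mem_empty_iff_false, iff_false]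
      exact not_failF_of_ntilde_eq_zero _ _ T hn
    rw [hempty, measure_empty]
    exact bot_le
  · have hnpos : (0 : ℝ) < T.ntilde := by exact_mod_cast hn
    have hp : 0 < η / T.ntilde := div_pos hη hnpos
    have hc : lam T.ntilde η * u = Real.sqrt (2 * Real.log (2 / (η / T.ntilde))) * u := by
      rw [lam, div_div_eq_mul_div]
    calc μ {ω | FailF (lam T.ntilde η * u) (fun j => δ j ω) T}
        ≤ (T.ntilde : ℝ≥0∞) * ENNReal.ofReal (η / T.ntilde) := measure_failF_le h hp hc T hT
      _ = ENNReal.ofReal η := by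
          rw [← ENNReal.ofReal_natCast, ← ENNReal.ofReal_mul (Nat.cast_nonneg _)]
          congr 1
          field_simp

/-! ### THEOREM 12 and COROLLARY 13: the recursive probabilistic bound -/

/-- **Theorem 12 for an arbitrary F-parameter `c ≥ 0`** (the common core of Theorem 12 and
Corollary 13): `μ {u √(2 ln(2/p)) √Ψ_c(T) < |e|} ≤ μ {some |f_k| > F_k} + p` — Lemma 3 (relaxed
Azuma–Hoeffding) for the martingale `Z_i = Σ_{j≤i} (s_j + f_j) δ_j`, whose increments obey
`|Z_i − Z_{i−1}| ≤ u(|s_i| + F_i)` off the failure event.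
[cite: HallmanIpsen2023, §2.2, Theorem 12, proof] -/
theorem errBound_recursive_of_failF (h : SRErrorModel μ u δ) {T : STree} (hT : T.WellLabeled)
    {c p : ℝ} (hc : 0 ≤ c) (hp : 0 < p) :
    μ {ω | u * Real.sqrt (2 * Real.log (2 / p)) * Real.sqrt (Psi c T)
        < |(T.inst fun j => δ j ω).err|}
      ≤ μ {ω | FailF c (fun j => δ j ω) T} + ENNReal.ofReal p := by
  have hu : 0 ≤ u := u_nonneg h
  set N : ℕ := T.labels.sup id + 1 with hN
  have hlab : ∀ j ∈ T.labels, j < N := fun j hj =>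
    Nat.lt_succ_of_le (Finset.le_sup (f := id) hj)
  set a : ℕ → Ω → ℝ := fun i ω => coef (fun j => δ j ω) T i with ha
  set A : ℕ → ℝ := fun i => coefBound c T i with hA
  have hP : IsPredictable δ a := isPredictable_coef hT
  have hA0 : ∀ i, 0 ≤ A i := fun i => coefBound_nonneg hc i T
  have hvar : ∑ i ∈ range N, (A i * u) ^ 2 = u ^ 2 * Psi c T := by
    rw [← sum_sq_coefBound c T hT hlab, mul_sum]
    exact sum_congr rfl (fun i _ => by ring)
  have hrad : azumaRadius (∑ i ∈ range N, (A i * u) ^ 2) p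
      = u * Real.sqrt (2 * Real.log (2 / p)) * Real.sqrt (Psi c T) := by
    rw [hvar, azumaRadius, sqrt_sq_mul hu]; ring
  have hsub : {ω | u * Real.sqrt (2 * Real.log (2 / p)) * Real.sqrt (Psi c T)
        < |(T.inst fun j => δ j ω).err|}
      ⊆ {ω | FailF c (fun j => δ j ω) T}
        ∪ {ω | azumaRadius (∑ i ∈ range N, (A i * u) ^ 2) p < |truncTransform a A δ N ω|} := by
    intro ω hω
    simp only [Set.mem_setOf_eq, Set.mem_union] at hω ⊢
    by_cases hF : FailF c (fun j => δ j ω) T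
    · exact Or.inl hF
    · right
      have hbd : ∀ i < N, |a i ω| ≤ A i := fun i _ => abs_coef_le_coefBound _ hc i T hF
      rw [hrad, truncTransform_eq_transform hbd, transform, ← err_inst_eq_sum _ T hlab]
      exact hω
  calc μ {ω | u * Real.sqrt (2 * Real.log (2 / p)) * Real.sqrt (Psi c T)
          < |(T.inst fun j => δ j ω).err|}
      ≤ μ {ω | FailF c (fun j => δ j ω) T}
        + μ {ω | azumaRadius (∑ i ∈ range N, (A i * u) ^ 2) p < |truncTransform a A δ N ω|} :=
        (measure_mono hsub).trans (measure_union_le _ _)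
    _ ≤ μ {ω | FailF c (fun j => δ j ω) T} + ENNReal.ofReal p := by
        gcongr
        exact azumaHoeffding_trunc h hP hA0 N hp

/-- **THEOREM 12 (Hallman–Ipsen): recursive probabilistic error bound for summation on any
computational tree.** Under the model (model:second), for a well-labelled summation tree and
`0 < η`, `0 < p` (HI's `δ`): with probability at least `1 − (p + η)`,
`|e_n| ≤ u √(2 ln(2/p)) (Σ_{j=2}^n (|s_j| + F_{j,ñ,η})²)^{1/2}`; i.e.
`μ {u √(2 ln(2/p)) √Ψ < |e_n|} ≤ p + η` with `Ψ = Σ_j (|s_j| + F_{j,ñ,η})²` (`Psi (lam ñ η * u) T`).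
[cite: HallmanIpsen2023, §2.2, Theorem 12 (thm:model2Theorem, Thm. 12 of the arXiv text),
eq. (eqn:model2errBound)] -/
theorem errBound_recursive (h : SRErrorModel μ u δ) {T : STree} (hT : T.WellLabeled) {η p : ℝ}
    (hη : 0 < η) (hp : 0 < p) :
    μ {ω | u * Real.sqrt (2 * Real.log (2 / p)) * Real.sqrt (Psi (lam T.ntilde η * u) T)
        < |(T.inst fun j => δ j ω).err|} ≤ ENNReal.ofReal (p + η) := by
  have hu : 0 ≤ u := u_nonneg h
  have hc : 0 ≤ lam T.ntilde η * u := mul_nonneg (lam_nonneg _ _) hu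
  calc _ ≤ μ {ω | FailF (lam T.ntilde η * u) (fun j => δ j ω) T} + ENNReal.ofReal p :=
        errBound_recursive_of_failF h hT hc hp
    _ ≤ ENNReal.ofReal η + ENNReal.ofReal p := by
        gcongr; exact measure_failF_le_eta h hT hη
    _ = ENNReal.ofReal (p + η) := by rw [ENNReal.ofReal_add hp.le hη.le, add_comm]

/-- **COROLLARY 13 (Hallman–Ipsen): the simpler bound with `n` in place of `ñ`.** Under the model
(model:second), with probability at least `1 − (p + η)`,
`|e_n| ≤ u √(2 ln(2/p)) (Σ_{j=2}^n (|s_j| + F_{j,n,η})²)^{1/2}`, where the F-bounds are built with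
`λ_{n,η} = √(2 ln(2n/η))`, `n` = the number of inputs (no knowledge of `L` required). (The second,
asymptotic line of the Corollary, `= u √(2 ln(2/p)) (Σ s_k²)^{1/2} + O(u²)`, is not typed.)
[cite: HallmanIpsen2023, §2.2, Corollary 13 (c_28, Cor. 13 of the arXiv text), first line] -/
theorem errBound_recursive_numInputs (h : SRErrorModel μ u δ) {T : STree} (hT : T.WellLabeled)
    {η p : ℝ} (hη : 0 < η) (hp : 0 < p) :
    μ {ω | u * Real.sqrt (2 * Real.log (2 / p)) * Real.sqrt (Psi (lam T.numInputs η * u) T)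
        < |(T.inst fun j => δ j ω).err|} ≤ ENNReal.ofReal (p + η) := by
  have hu : 0 ≤ u := u_nonneg h
  refine (measure_mono ?_).trans (errBound_recursive h hT hη hp)
  intro ω hω
  simp only [Set.mem_setOf_eq] at hω ⊢
  refine lt_of_le_of_lt (mul_le_mul_of_nonneg_left (Real.sqrt_le_sqrt (Psi_mono
    (mul_nonneg (lam_nonneg _ _) hu) ?_ T)) (by positivity)) hω
  exact mul_le_mul_of_nonneg_right (lam_mono (ntilde_lt_numInputs T).le hη) hu

end Probabilistic

/-! ### The closed form (proof of THEOREM 15): Minkowski per level, binomial counting, `φ` -/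

section ClosedForm

/-- LEVEL SUMS `Σ_{chains j_0 ≻ j_1 ≻ ⋯ ≻ j_m} W(j_m)` over descending chains of `m + 1` nodes
(each a strict descendant of the previous one), `W` a weight attached to nodes (read off at the
ROOT of the subtree a node spans) — the iterated sums `Σ_{j_2 ≺ j_1 ⪯ n}`, `Σ_{j_3 ≺ j_2 ≺ j_1 ⪯ n}`, …
of Hallman–Ipsen's proof of Theorem 15, defined by the recursion
`level(node, m+1) = level(l, m) + level(r, m) + level(l, m+1) + level(r, m+1)`.
[cite: HallmanIpsen2023, §2.2, Theorem 15, proof ("Repeating this …", the sums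
`Σ_{j_2 ≺ j_1 ⪯ n} s_{j_2}²`)] -/
def level (W : STree → ℝ) : STree → ℕ → ℝ
  | leaf _, _ => 0
  | node k l r, 0 => W (node k l r) + level W l 0 + level W r 0
  | node _ l r, m + 1 => level W l m + level W r m + level W l (m + 1) + level W r (m + 1)

/-- Node weight `(|s_j| + F_j)²`. [cite: HallmanIpsen2023, §2.2, Theorem 15, proof] -/
noncomputable def wP (c : ℝ) : STree → ℝ
  | leaf _ => 0
  | node k l r => (|exactVal l + exactVal r| + Fb c (node k l r)) ^ 2

/-- Node weight `s_j²`. [cite: HallmanIpsen2023, §2.2, Theorem 15, proof] -/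
def wS : STree → ℝ
  | leaf _ => 0
  | node _ l r => (exactVal l + exactVal r) ^ 2

/-- Node weight `F_j²`. [cite: HallmanIpsen2023, §2.2, Theorem 15, proof] -/
noncomputable def wQ (c : ℝ) : STree → ℝ
  | leaf _ => 0
  | node k l r => Fb c (node k l r) ^ 2

/-- [folklore] level sums of a leaf vanish. -/
@[simp] private theorem level_leaf (W : STree → ℝ) (x : ℝ) (m : ℕ) : level W (leaf x) m = 0 := by
  cases m <;> rfl

/-- [folklore] level sums of nonnegative weights are nonnegative. -/
private theorem level_nonneg {W : STree → ℝ} (hW : ∀ S, 0 ≤ W S) : ∀ (T : STree) (m : ℕ),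
    0 ≤ level W T m
  | leaf _, m => by simp
  | node k l r, 0 => by
      simp only [level]
      exact add_nonneg (add_nonneg (hW _) (level_nonneg hW l 0)) (level_nonneg hW r 0)
  | node k l r, m + 1 => by
      simp only [level]
      have := level_nonneg hW l m; have := level_nonneg hW r m
      have := level_nonneg hW l (m+1); have := level_nonneg hW r (m+1)
      positivity

/-- [folklore] `(|s| + F)² ≥ 0`. -/
private theorem wP_nonneg (c : ℝ) (S : STree) : 0 ≤ wP c S := by
  cases S <;> simp only [wP] <;> positivity

/-- [folklore] `s² ≥ 0`. -/
private theorem wS_nonneg (S : STree) : 0 ≤ wS S := by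
  cases S <;> simp only [wS] <;> positivity

/-- [folklore] `F² ≥ 0`. -/
private theorem wQ_nonneg (c : ℝ) (S : STree) : 0 ≤ wQ c S := by
  cases S <;> simp only [wQ] <;> positivity

/-- Level `0` of the weights `(|s_j| + F_j)²` is `Ψ`. [cite: HallmanIpsen2023, §2.2, Theorem 15,
proof (first display)] -/
theorem level_wP_zero (c : ℝ) : ∀ T : STree, level (wP c) T 0 = Psi c T
  | leaf _ => by simp [Psi]
  | node k l r => by
      simp only [level, wP, Psi_node, level_wP_zero c l, level_wP_zero c r]

/-- Level `0` of the weights `s_j²` is `Σ s_k²`. [cite: HallmanIpsen2023, §2.2, Theorem 15, proof] -/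
theorem level_wS_zero : ∀ T : STree, level wS T 0 = T.sumSq
  | leaf _ => by simp [sumSq]
  | node k l r => by simp only [level, wS, sumSq, level_wS_zero l, level_wS_zero r]

/-- **The F-recursion, one level down**: `Σ_{chains} F_{j_m}² = c² · Σ_{chains one longer} (|s| + F)²`
(`F_j² = c² Σ_{i ≺ j} (|s_i| + F_i)²`). [cite: HallmanIpsen2023, §2.2, Theorem 15, proof ("Apply
the recurrence for `F_{j,ñ,η}` from (eqn:FBoundRecurrence)")] -/
theorem level_wQ (c : ℝ) : ∀ (T : STree) (m : ℕ), level (wQ c) T m = c ^ 2 * level (wP c) T (m + 1)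
  | leaf _, m => by simp
  | node k l r, 0 => by
      have hF : Fb c (node k l r) ^ 2 = c ^ 2 * (Psi c l + Psi c r) := by
        simp only [Fb]
        rw [mul_pow, Real.sq_sqrt (add_nonneg (Psi_nonneg c l) (Psi_nonneg c r))]
      simp only [level, wQ, level_wQ c l 0, level_wQ c r 0, level_wP_zero, hF]
      ring
  | node k l r, m + 1 => by
      simp only [level, level_wQ c l, level_wQ c r]
      ring

/-- [folklore] Minkowski's inequality is additive: the 2-norm triangle inequality for a
concatenation follows from the two halves (Cauchy–Schwarz in the plane). -/
private theorem mink_add {P₁ P₂ S₁ S₂ Q₁ Q₂ : ℝ} (hP₁ : 0 ≤ P₁) (hP₂ : 0 ≤ P₂) (hS₁ : 0 ≤ S₁)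
    (hS₂ : 0 ≤ S₂) (hQ₁ : 0 ≤ Q₁) (hQ₂ : 0 ≤ Q₂)
    (h₁ : Real.sqrt P₁ ≤ Real.sqrt S₁ + Real.sqrt Q₁)
    (h₂ : Real.sqrt P₂ ≤ Real.sqrt S₂ + Real.sqrt Q₂) :
    Real.sqrt (P₁ + P₂) ≤ Real.sqrt (S₁ + S₂) + Real.sqrt (Q₁ + Q₂) := by
  set a := Real.sqrt S₁ with ha
  set b := Real.sqrt S₂ with hb
  set x := Real.sqrt Q₁ with hx
  set y := Real.sqrt Q₂ with hy
  have ha0 : 0 ≤ a := Real.sqrt_nonneg _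
  have hb0 : 0 ≤ b := Real.sqrt_nonneg _
  have hx0 : 0 ≤ x := Real.sqrt_nonneg _
  have hy0 : 0 ≤ y := Real.sqrt_nonneg _
  have ha2 : a ^ 2 = S₁ := Real.sq_sqrt hS₁
  have hb2 : b ^ 2 = S₂ := Real.sq_sqrt hS₂
  have hx2 : x ^ 2 = Q₁ := Real.sq_sqrt hQ₁
  have hy2 : y ^ 2 = Q₂ := Real.sq_sqrt hQ₂
  have e₁ : P₁ ≤ (a + x) ^ 2 := by
    have := Real.sq_sqrt hP₁
    nlinarith [Real.sqrt_nonneg P₁]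
  have e₂ : P₂ ≤ (b + y) ^ 2 := by
    have := Real.sq_sqrt hP₂
    nlinarith [Real.sqrt_nonneg P₂]
  -- Cauchy–Schwarz in the plane: `a x + b y ≤ √(a²+b²) √(x²+y²)`
  have cs : a * x + b * y ≤ Real.sqrt (S₁ + S₂) * Real.sqrt (Q₁ + Q₂) := by
    rw [← Real.sqrt_mul (add_nonneg hS₁ hS₂)]
    refine (le_abs_self _).trans (Real.abs_le_sqrt ?_)
    rw [← ha2, ← hb2, ← hx2, ← hy2]
    nlinarith [sq_nonneg (a * y - b * x)]
  have hXY : 0 ≤ Real.sqrt (S₁ + S₂) + Real.sqrt (Q₁ + Q₂) := by positivity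
  rw [Real.sqrt_le_left hXY]
  have hX2 : Real.sqrt (S₁ + S₂) ^ 2 = S₁ + S₂ := Real.sq_sqrt (add_nonneg hS₁ hS₂)
  have hY2 : Real.sqrt (Q₁ + Q₂) ^ 2 = Q₁ + Q₂ := Real.sq_sqrt (add_nonneg hQ₁ hQ₂)
  nlinarith [e₁, e₂, cs, hX2, hY2, ha2, hb2, hx2, hy2]

/-- **Minkowski per level**: `(Σ_{chains} (|s| + F)²)^{1/2} ≤ (Σ_{chains} s²)^{1/2} + (Σ_{chains} F²)^{1/2}`
("Apply the 2-norm triangle inequality"). [cite: HallmanIpsen2023, §2.2, Theorem 15, proof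
(first and second displays)] -/
theorem sqrt_level_wP_le {c : ℝ} (hc : 0 ≤ c) : ∀ (T : STree) (m : ℕ),
    Real.sqrt (level (wP c) T m) ≤ Real.sqrt (level wS T m) + Real.sqrt (level (wQ c) T m)
  | leaf _, m => by simp
  | node k l r, 0 => by
      simp only [level]
      have hatom : Real.sqrt (wP c (node k l r)) ≤ Real.sqrt (wS (node k l r))
          + Real.sqrt (wQ c (node k l r)) := by
        simp only [wP, wS, wQ]
        rw [Real.sqrt_sq (add_nonneg (abs_nonneg _) (Fb_nonneg hc _)), Real.sqrt_sq_eq_abs,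
          Real.sqrt_sq (Fb_nonneg hc _)]
      exact mink_add (add_nonneg (wP_nonneg c _) (level_nonneg (wP_nonneg c) l 0))
        (level_nonneg (wP_nonneg c) r 0)
        (add_nonneg (wS_nonneg _) (level_nonneg wS_nonneg l 0)) (level_nonneg wS_nonneg r 0)
        (add_nonneg (wQ_nonneg c _) (level_nonneg (wQ_nonneg c) l 0))
        (level_nonneg (wQ_nonneg c) r 0)
        (mink_add (wP_nonneg c _) (level_nonneg (wP_nonneg c) l 0) (wS_nonneg _)
          (level_nonneg wS_nonneg l 0) (wQ_nonneg c _) (level_nonneg (wQ_nonneg c) l 0)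
          hatom (sqrt_level_wP_le hc l 0))
        (sqrt_level_wP_le hc r 0)
  | node k l r, m + 1 => by
      simp only [level]
      have hPl := level_nonneg (wP_nonneg c) l m; have hPr := level_nonneg (wP_nonneg c) r m
      have hPl' := level_nonneg (wP_nonneg c) l (m + 1)
      have hPr' := level_nonneg (wP_nonneg c) r (m + 1)
      have hSl := level_nonneg wS_nonneg l m; have hSr := level_nonneg wS_nonneg r m
      have hSl' := level_nonneg wS_nonneg l (m + 1); have hSr' := level_nonneg wS_nonneg r (m + 1)
      have hQl := level_nonneg (wQ_nonneg c) l m; have hQr := level_nonneg (wQ_nonneg c) r m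
      have hQl' := level_nonneg (wQ_nonneg c) l (m + 1)
      have hQr' := level_nonneg (wQ_nonneg c) r (m + 1)
      exact mink_add (add_nonneg (add_nonneg hPl hPr) hPl') hPr'
        (add_nonneg (add_nonneg hSl hSr) hSl') hSr' (add_nonneg (add_nonneg hQl hQr) hQl') hQr'
        (mink_add (add_nonneg hPl hPr) hPl' (add_nonneg hSl hSr) hSl' (add_nonneg hQl hQr) hQl'
          (mink_add hPl hPr hSl hSr hQl hQr (sqrt_level_wP_le hc l m) (sqrt_level_wP_le hc r m))
          (sqrt_level_wP_le hc l (m + 1)))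
        (sqrt_level_wP_le hc r (m + 1))

/-- Chains of `m + 1` nodes need height `> m`: the level sums vanish from level `h` on.
[cite: HallmanIpsen2023, §2.2, Theorem 15, proof ("Repeating this" — `h` times)] -/
theorem level_eq_zero_of_height_le (W : STree → ℝ) : ∀ (T : STree) (m : ℕ), T.height ≤ m →
    level W T m = 0
  | leaf _, m, _ => by simp
  | node k l r, 0, h => by simp [height] at h
  | node k l r, m + 1, h => by
      simp only [height] at h
      have hl : l.height ≤ m := by omega
      have hr : r.height ≤ m := by omega
      simp only [level, level_eq_zero_of_height_le W l m hl, level_eq_zero_of_height_le W r m hr,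
        level_eq_zero_of_height_le W l (m + 1) (by omega),
        level_eq_zero_of_height_le W r (m + 1) (by omega), add_zero]

/-- **Counting chains**: each partial sum `s_k` heads at most `(h choose m)` descending chains of
length `m` ("for each index `j_2` there are at most `h` possibilities for `j_1`"), so
`Σ_{chains} s_{j_m}² ≤ (h choose m) Σ_k s_k²`. [cite: HallmanIpsen2023, §2.2, Theorem 15, proof
(the inequality with `√(h choose 1)`, and "Repeating this")] -/
theorem level_wS_le_choose : ∀ (T : STree) (m : ℕ),
    level wS T m ≤ (T.height.choose m : ℝ) * T.sumSq
  | leaf _, m => by simp [sumSq]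
  | node k l r, 0 => by simp [level_wS_zero]
  | node k l r, m + 1 => by
      have ihl := level_wS_le_choose l m
      have ihr := level_wS_le_choose r m
      have ihl' := level_wS_le_choose l (m + 1)
      have ihr' := level_wS_le_choose r (m + 1)
      set H := max l.height r.height with hH
      have hcl : (l.height.choose m : ℝ) ≤ H.choose m := by
        exact_mod_cast Nat.choose_le_choose m (le_max_left _ _)
      have hcr : (r.height.choose m : ℝ) ≤ H.choose m := by
        exact_mod_cast Nat.choose_le_choose m (le_max_right _ _)
      have hcl' : (l.height.choose (m + 1) : ℝ) ≤ H.choose (m + 1) := by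
        exact_mod_cast Nat.choose_le_choose (m + 1) (le_max_left _ _)
      have hcr' : (r.height.choose (m + 1) : ℝ) ≤ H.choose (m + 1) := by
        exact_mod_cast Nat.choose_le_choose (m + 1) (le_max_right _ _)
      have hchoose : ((node k l r).height.choose (m + 1) : ℝ) = H.choose m + H.choose (m + 1) := by
        simp only [height, ← hH, Nat.choose_succ_succ, Nat.cast_add]
      have hSl := sumSq_nonneg l
      have hSr := sumSq_nonneg r
      simp only [level, sumSq, hchoose]
      have h1 : level wS l m ≤ (H.choose m : ℝ) * l.sumSq :=
        ihl.trans (mul_le_mul_of_nonneg_right hcl hSl)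
      have h2 : level wS r m ≤ (H.choose m : ℝ) * r.sumSq :=
        ihr.trans (mul_le_mul_of_nonneg_right hcr hSr)
      have h3 : level wS l (m + 1) ≤ (H.choose (m + 1) : ℝ) * l.sumSq :=
        ihl'.trans (mul_le_mul_of_nonneg_right hcl' hSl)
      have h4 : level wS r (m + 1) ≤ (H.choose (m + 1) : ℝ) * r.sumSq :=
        ihr'.trans (mul_le_mul_of_nonneg_right hcr' hSr)
      have h5 : (0 : ℝ) ≤ H.choose m := Nat.cast_nonneg _
      have h6 : (0 : ℝ) ≤ H.choose (m + 1) := Nat.cast_nonneg _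
      nlinarith [sq_nonneg (exactVal l + exactVal r)]

/-- **Unrolling the F-recursion** (`M` levels): `√Ψ ≤ Σ_{m<M} c^m (Σ_{level m} s²)^{1/2}
+ c^M (Σ_{level M} (|s| + F)²)^{1/2}`. [cite: HallmanIpsen2023, §2.2, Theorem 15, proof
("Repeating this and combining the result with Theorem 12")] -/
theorem sqrt_Psi_le_unroll {c : ℝ} (hc : 0 ≤ c) (T : STree) : ∀ M : ℕ,
    Real.sqrt (Psi c T) ≤ (∑ m ∈ range M, c ^ m * Real.sqrt (level wS T m))
      + c ^ M * Real.sqrt (level (wP c) T M)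
  | 0 => by simp [level_wP_zero]
  | M + 1 => by
      have ih := sqrt_Psi_le_unroll hc T M
      have hstep : Real.sqrt (level (wP c) T M)
          ≤ Real.sqrt (level wS T M) + c * Real.sqrt (level (wP c) T (M + 1)) := by
        have h1 := sqrt_level_wP_le hc T M
        rwa [level_wQ, Real.sqrt_mul (sq_nonneg c), Real.sqrt_sq hc] at h1
      rw [sum_range_succ, pow_succ]
      have hcM : 0 ≤ c ^ M := pow_nonneg hc M
      nlinarith [mul_le_mul_of_nonneg_left hstep hcM]

/-- **Eq. (eqn:model2binomials), the deterministic factor**: for every `c ≥ 0`,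
`√Ψ_c(T) ≤ (Σ_{m=0}^h c^m √(h choose m)) (Σ_k s_k²)^{1/2}`.
[cite: HallmanIpsen2023, §2.2, Theorem 15, proof, eq. (eqn:model2binomials)] -/
theorem sqrt_Psi_le_binomial {c : ℝ} (hc : 0 ≤ c) (T : STree) :
    Real.sqrt (Psi c T) ≤ (∑ m ∈ range (T.height + 1), c ^ m * Real.sqrt (T.height.choose m))
      * Real.sqrt T.sumSq := by
  have h1 := sqrt_Psi_le_unroll hc T T.height
  rw [level_eq_zero_of_height_le (wP c) T T.height le_rfl, Real.sqrt_zero, mul_zero, add_zero] at h1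
  refine h1.trans ?_
  rw [sum_mul, sum_range_succ]
  refine le_trans (sum_le_sum (fun m _ => ?_)) (le_add_of_nonneg_right (by positivity))
  rw [mul_assoc, ← Real.sqrt_mul (Nat.cast_nonneg _)]
  exact mul_le_mul_of_nonneg_left (Real.sqrt_le_sqrt (level_wS_le_choose T m)) (pow_nonneg hc m)

/-- [folklore] the geometric sum `Σ_{m<h} (1/2)^{m+1} = 1 − (1/2)^h ≤ 1`. -/
private theorem geom_half_le_one (h : ℕ) : ∑ m ∈ range h, (1 / 2 : ℝ) ^ (m + 1) ≤ 1 := by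
  have : ∑ m ∈ range h, (1 / 2 : ℝ) ^ (m + 1) = 1 - (1 / 2) ^ h := by
    induction h with
    | zero => simp
    | succ n ih => rw [sum_range_succ, ih]; ring
  rw [this]
  have : (0 : ℝ) ≤ (1 / 2) ^ h := by positivity
  linarith

/-- [folklore] `e^y − 1 ≤ y e^y` (for every real `y`, from `1 − y ≤ e^{−y}`). -/
private theorem exp_sub_one_le_mul_exp (y : ℝ) : Real.exp y - 1 ≤ y * Real.exp y := by
  have h1 : -y + 1 ≤ Real.exp (-y) := Real.add_one_le_exp (-y)
  have h2 : Real.exp (-y) * Real.exp y = 1 := by rw [← Real.exp_add]; simp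
  nlinarith [Real.exp_pos y, Real.exp_pos (-y)]

/-- **The `φ` bound**: `Σ_{m=1}^h c^m √(h choose m) ≤ c √(2h) exp(c² h)` (Cauchy–Schwarz with weights
`2^m`, `Σ_m 2^m c^{2m} (h choose m) = (1 + 2c²)^h − 1 ≤ exp(2c²h) − 1 ≤ 2c²h exp(2c²h)`), hence
`Σ_{m=0}^h c^m √(h choose m) ≤ 1 + c √(2h) exp(c² h)`.
[cite: HallmanIpsen2023, §2.2, Theorem 15, proof, eq. (eqn:CSineq) and the final display] -/
theorem binomialSum_le_one_add {c : ℝ} (hc : 0 ≤ c) (h : ℕ) :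
    ∑ m ∈ range (h + 1), c ^ m * Real.sqrt (h.choose m)
      ≤ 1 + c * Real.sqrt (2 * h) * Real.exp (c ^ 2 * h) := by
  rw [sum_range_succ']
  simp only [pow_zero, Nat.choose_zero_right, Nat.cast_one, Real.sqrt_one, mul_one]
  rw [add_comm]
  refine add_le_add le_rfl ?_
  -- the tail `Σ_{m<h} c^(m+1) √(h choose (m+1))`
  set R : ℝ := ∑ m ∈ range h, c ^ (m + 1) * Real.sqrt (h.choose (m + 1)) with hR
  have hR0 : 0 ≤ R := sum_nonneg (fun m _ => by positivity)
  -- Cauchy–Schwarz with weights `(1/2)^(m+1)` and `2^(m+1)`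
  have hCS : R ^ 2 ≤ (∑ m ∈ range h, (1 / 2 : ℝ) ^ (m + 1))
      * ∑ m ∈ range h, (2 : ℝ) ^ (m + 1) * (c ^ (m + 1)) ^ 2 * h.choose (m + 1) := by
    refine sum_sq_le_sum_mul_sum_of_sq_le_mul (range h) (fun m _ => by positivity)
      (fun m _ => by positivity) (fun m _ => le_of_eq ?_)
    rw [mul_pow, Real.sq_sqrt (Nat.cast_nonneg _)]
    have : (1 / 2 : ℝ) ^ (m + 1) * 2 ^ (m + 1) = 1 := by
      rw [← mul_pow]; norm_num
    calc (c ^ (m + 1)) ^ 2 * (h.choose (m + 1) : ℝ)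
        = ((1 / 2 : ℝ) ^ (m + 1) * 2 ^ (m + 1)) * ((c ^ (m + 1)) ^ 2 * h.choose (m + 1)) := by
          rw [this, one_mul]
      _ = _ := by ring
  -- the binomial theorem: `Σ_{m<h} 2^(m+1) c^(2(m+1)) (h choose (m+1)) = (1 + 2c²)^h − 1`
  have hbinom : ∑ m ∈ range h, (2 : ℝ) ^ (m + 1) * (c ^ (m + 1)) ^ 2 * h.choose (m + 1)
      = (2 * c ^ 2 + 1) ^ h - 1 := by
    have hap := add_pow (2 * c ^ 2) (1 : ℝ) h
    rw [sum_range_succ'] at hap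
    simp only [one_pow, mul_one, pow_zero, Nat.choose_zero_right, Nat.cast_one] at hap
    rw [hap, add_sub_cancel_right]
    exact sum_congr rfl (fun m _ => by ring)
  -- `(1 + 2c²)^h ≤ exp(2c²h)` and `e^y − 1 ≤ y e^y`
  set y : ℝ := 2 * c ^ 2 * h with hy
  have hpow : (2 * c ^ 2 + 1) ^ h ≤ Real.exp y := by
    rw [hy, show 2 * c ^ 2 * (h : ℝ) = (h : ℝ) * (2 * c ^ 2) by ring, Real.exp_nat_mul]
    exact pow_le_pow_left₀ (by positivity) (Real.add_one_le_exp _) h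
  have hR2 : R ^ 2 ≤ y * Real.exp y := by
    calc R ^ 2 ≤ 1 * ((2 * c ^ 2 + 1) ^ h - 1) := by
          rw [← hbinom]
          exact hCS.trans (mul_le_mul_of_nonneg_right (geom_half_le_one h)
            (sum_nonneg (fun m _ => by positivity)))
      _ ≤ Real.exp y - 1 := by linarith
      _ ≤ y * Real.exp y := exp_sub_one_le_mul_exp y
  -- `y e^y = (c √(2h) exp(c²h))²`
  have hsq : (c * Real.sqrt (2 * h) * Real.exp (c ^ 2 * h)) ^ 2 = y * Real.exp y := by
    rw [mul_pow, mul_pow, Real.sq_sqrt (by positivity), ← Real.exp_nat_mul]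
    push_cast
    rw [show (2 : ℝ) * (c ^ 2 * (h : ℝ)) = y from by rw [hy]; ring, hy]
    ring
  have hrhs : 0 ≤ c * Real.sqrt (2 * h) * Real.exp (c ^ 2 * h) := by positivity
  exact (sq_le_sq₀ hR0 hrhs).mp (hsq ▸ hR2)

/-- **The closed-form deterministic factor**: for every `c ≥ 0`,
`√Ψ_c(T) ≤ (1 + c √(2h) exp(c² h)) (Σ_k s_k²)^{1/2}`; with `c = λ u` the factor is `1 + φ`.
[cite: HallmanIpsen2023, §2.2, Theorem 15, proof (substituting the `φ` bound into
eq. (eqn:model2binomials))] -/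
theorem sqrt_Psi_le_closedForm {c : ℝ} (hc : 0 ≤ c) (T : STree) :
    Real.sqrt (Psi c T) ≤ (1 + c * Real.sqrt (2 * T.height) * Real.exp (c ^ 2 * T.height))
      * Real.sqrt T.sumSq :=
  (sqrt_Psi_le_binomial hc T).trans (mul_le_mul_of_nonneg_right (binomialSum_le_one_add hc _)
    (Real.sqrt_nonneg _))

/-- `φ` in terms of `c = λ u`: `1 + φ_{·,h,η} = 1 + c √(2h) exp(c² h)`.
[cite: HallmanIpsen2023, §2.2, Theorem 15, eq. (eqn:lnlh)] -/
theorem phi_eq (lam' u : ℝ) (h : ℕ) :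
    phi lam' h u = (lam' * u) * Real.sqrt (2 * h) * Real.exp ((lam' * u) ^ 2 * h) := by
  rw [show (lam' * u) ^ 2 * (h : ℝ) = lam' ^ 2 * h * u ^ 2 by ring, phi]
  ring

end ClosedForm

/-! ### THEOREM 15 and COROLLARY 17: the closed-form probabilistic bounds -/

section ClosedFormProb

variable {Ω : Type*} [MeasurableSpace Ω] {μ : Measure Ω} {u : ℝ} {δ : ℕ → Ω → ℝ}
  [IsProbabilityMeasure μ]

/-- From a Theorem-12-type bound with F-parameter `c = λ' u` to the two closed-form bounds with
`φ = λ' √(2h) u exp(λ'² h u²)` (the deterministic steps of the proof of Theorem 15: the `φ` bound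
and `(Σ s_k²)^{1/2} ≤ √h Σ|x_k|` from Lemma 5).
[cite: HallmanIpsen2023, §2.2, Theorem 15, proof; §2, Lemma 5] -/
theorem errBound_closedForm_of_recursive (h : SRErrorModel μ u δ) (T : STree) {lam' p : ℝ}
    (hl : 0 ≤ lam') {B : ℝ≥0∞}
    (hB : μ {ω | u * Real.sqrt (2 * Real.log (2 / p)) * Real.sqrt (Psi (lam' * u) T)
        < |(T.inst fun j => δ j ω).err|} ≤ B) :
    μ {ω | u * Real.sqrt (2 * Real.log (2 / p)) * (1 + phi lam' T.height u) * Real.sqrt T.sumSq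
        < |(T.inst fun j => δ j ω).err|} ≤ B ∧
    μ {ω | u * Real.sqrt T.height * Real.sqrt (2 * Real.log (2 / p)) * (1 + phi lam' T.height u)
        * T.absInputs < |(T.inst fun j => δ j ω).err|} ≤ B := by
  have hu : 0 ≤ u := u_nonneg h
  have hc : 0 ≤ lam' * u := mul_nonneg hl hu
  have hphi : 0 ≤ phi lam' T.height u := phi_nonneg hl hu _
  -- threshold of Theorem 12 ≤ first closed-form threshold ≤ second closed-form threshold
  have h1 : u * Real.sqrt (2 * Real.log (2 / p)) * Real.sqrt (Psi (lam' * u) T)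
      ≤ u * Real.sqrt (2 * Real.log (2 / p)) * (1 + phi lam' T.height u) * Real.sqrt T.sumSq := by
    have := sqrt_Psi_le_closedForm hc T
    rw [← phi_eq] at this
    calc u * Real.sqrt (2 * Real.log (2 / p)) * Real.sqrt (Psi (lam' * u) T)
        ≤ u * Real.sqrt (2 * Real.log (2 / p)) * ((1 + phi lam' T.height u) * Real.sqrt T.sumSq) :=
          mul_le_mul_of_nonneg_left this (by positivity)
      _ = _ := by ring
  have h2 : u * Real.sqrt (2 * Real.log (2 / p)) * (1 + phi lam' T.height u) * Real.sqrt T.sumSq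
      ≤ u * Real.sqrt T.height * Real.sqrt (2 * Real.log (2 / p)) * (1 + phi lam' T.height u)
        * T.absInputs := by
    have hss : Real.sqrt T.sumSq ≤ Real.sqrt T.height * T.absInputs := by
      have := Real.sqrt_le_sqrt (sumSq_le_height_mul_sq T)
      rwa [Real.sqrt_mul (Nat.cast_nonneg _), Real.sqrt_sq (absInputs_nonneg T)] at this
    calc u * Real.sqrt (2 * Real.log (2 / p)) * (1 + phi lam' T.height u) * Real.sqrt T.sumSq
        ≤ u * Real.sqrt (2 * Real.log (2 / p)) * (1 + phi lam' T.height u)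
          * (Real.sqrt T.height * T.absInputs) :=
          mul_le_mul_of_nonneg_left hss (by positivity)
      _ = _ := by ring
  constructor
  · refine (measure_mono (fun ω hω => ?_)).trans hB
    simp only [Set.mem_setOf_eq] at hω ⊢
    exact lt_of_le_of_lt h1 hω
  · refine (measure_mono (fun ω hω => ?_)).trans hB
    simp only [Set.mem_setOf_eq] at hω ⊢
    exact lt_of_le_of_lt (h1.trans h2) hω

/-- **THEOREM 15 (Hallman–Ipsen): closed-form probabilistic error bound for summation on any
computational tree.** Under the model (model:second), for a well-labelled summation tree of height
`h` with `ñ` nodes having a non-leaf child, and `0 < η`, `0 < p` (HI's `δ`): with probability at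
least `1 − (p + η)`,
`|e_n| ≤ u √(2 ln(2/p)) (1 + φ_{ñ,h,η}) (Σ_k s_k²)^{1/2} ≤ u √h √(2 ln(2/p)) (1 + φ_{ñ,h,η}) Σ_k |x_k|`,
`φ_{ñ,h,η} = λ_{ñ,η} √(2h) u exp(λ²_{ñ,η} h u²)`, `λ_{ñ,η} = √(2 ln(2ñ/η))` — the error grows like
`√h u` to first order. Both lines are stated as tail bounds `μ {bound < |e_n|} ≤ p + η`.
[cite: HallmanIpsen2023, §2.2, Theorem 15 (thm:model2Analysis, Thm. 15 of the arXiv text),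
eq. (eqn:lnlh)] -/
theorem errBound_closedForm (h : SRErrorModel μ u δ) {T : STree} (hT : T.WellLabeled) {η p : ℝ}
    (hη : 0 < η) (hp : 0 < p) :
    μ {ω | u * Real.sqrt (2 * Real.log (2 / p)) * (1 + phi (lam T.ntilde η) T.height u)
        * Real.sqrt T.sumSq < |(T.inst fun j => δ j ω).err|} ≤ ENNReal.ofReal (p + η) ∧
    μ {ω | u * Real.sqrt T.height * Real.sqrt (2 * Real.log (2 / p))
        * (1 + phi (lam T.ntilde η) T.height u) * T.absInputs < |(T.inst fun j => δ j ω).err|}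
      ≤ ENNReal.ofReal (p + η) :=
  errBound_closedForm_of_recursive h T (lam_nonneg _ _) (errBound_recursive h hT hη hp)

/-- **COROLLARY 17 (Hallman–Ipsen): the closed-form bound with `n` in place of `ñ`.** Under the
model (model:second), with probability at least `1 − (p + η)`,
`|e_n| ≤ u √(2 ln(2/p)) (1 + φ_{n,h,η}) (Σ_k s_k²)^{1/2} ≤ u √h √(2 ln(2/p)) (1 + φ_{n,h,η}) Σ_k |x_k|`,
`φ_{n,h,η} = λ_{n,η} √(2h) u exp(λ²_{n,η} h u²)`, `λ_{n,η} = √(2 ln(2n/η))`, `n` = number of inputs.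
[cite: HallmanIpsen2023, §2.2, Corollary 17 (c_210, Cor. 17 of the arXiv text), eq. (e_lnh)] -/
theorem errBound_closedForm_numInputs (h : SRErrorModel μ u δ) {T : STree} (hT : T.WellLabeled)
    {η p : ℝ} (hη : 0 < η) (hp : 0 < p) :
    μ {ω | u * Real.sqrt (2 * Real.log (2 / p)) * (1 + phi (lam T.numInputs η) T.height u)
        * Real.sqrt T.sumSq < |(T.inst fun j => δ j ω).err|} ≤ ENNReal.ofReal (p + η) ∧
    μ {ω | u * Real.sqrt T.height * Real.sqrt (2 * Real.log (2 / p))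
        * (1 + phi (lam T.numInputs η) T.height u) * T.absInputs
        < |(T.inst fun j => δ j ω).err|} ≤ ENNReal.ofReal (p + η) :=
  errBound_closedForm_of_recursive h T (lam_nonneg _ _) (errBound_recursive_numInputs h hT hη hp)

end ClosedFormProb

end STree

end Literature.ComputerArithmetic.HallmanIpsen2023
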